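import Literature.NumberTheory.LFunctions.ClassGroupLFunctionWindows
import Literature.NumberTheory.LFunctions.ClassGroupLogFreeLemmaA
import Literature.NumberTheory.LFunctions.ClassGroupLFunctionZeroFreeRegion
import Literature.NumberTheory.LFunctions.ClassGroupLFunctionRealZeros
import Literature.NumberTheory.LFunctions.ExplicitFormulaPsiOne
import Literature.NumberTheory.LFunctions.DedekindZetaPartialFraction
import HarnessLib

/-!
# `L'/L(s, χ)` in the strip `−1/2 ≤ σ ≤ 3/2` at good heights, uniformly in the field

Topic `Literature/NumberTheory/LFunctions`, namespace `Literature.NumberTheory.LFunctions.NumberField`.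
Everything here is PROVED (theorems only; no named facts).

The class-group analogue of the tree's `ExplicitPsiChar.exists_norm_logDeriv_LFunction_le_strip`
(Montgomery–Vaughan Lemmas 12.6–12.8): for a number field `K` of degree `n`, a class group
character `χ ≠ 1`, a height `|t| ≥ 2` and `0 < η ≤ 1` such that every non-trivial zero of `L₀(s, χ)`
is `η`-separated from `t` and every non-trivial zero of `L₀(s, χ⁻¹)` is `η`-separated from `−t`
(both follow from a good height, `ClassGroupLFunctionWindows`), and every `σ ∈ [−1/2, 3/2]`:

  `L(σ + it, χ) ≠ 0` and `‖L'/L(σ + it, χ)‖ ≤ 3 ℒ'_t / η`,  `ℒ'_t = lemmaAHeight K t`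

(`norm_logDeriv_classGroupLFunction_le_strip`). On `σ ≥ 1/4` this is the disc partial fraction
`L₀'/L₀ = Σ_ρ m(ρ)/(s − ρ) + O(ℒ)` (`ClassGroupLFunctionLocalL0`); on `σ < 1/4` the logarithmic
derivative of the functional equation, `L'/L(w, χ) = −γ'/γ(w) − γ'/γ(1 − w) − L'/L(1 − w, χ⁻¹)`
(`logDeriv_classGroupLFunction_reflect`), moves the point to `1 − w` for `χ⁻¹`, with the gamma
factor of logarithmic size on `−1/2 ≤ σ ≤ 3/2`, `|t| ≥ 2` (`norm_logDeriv_dedekindGammaFactor_le_horizontal`).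
Also: `classGroupLFunction₀_ne_zero_of_one_le_re` — `L₀(s, χ) ≠ 0` on `Re s ≥ 1` (the tree's
zero-free region and `L(1, χ) ≠ 0`).

## References

* H. L. Montgomery, R. C. Vaughan, *Multiplicative Number Theory I*, Lemmas 12.6–12.8. [MontgomeryVaughan2007]
* J. Thorner, A. Zaman, ANT 13 (2019), Lemma 2.6. [ThornerZaman2019]
-/

noncomputable section

open scoped NumberField nonZeroDivisors Real
open NumberField NumberField.InfinitePlace Complex Filter Topology Set Metric Finset

namespace Literature.NumberTheory.LFunctions.NumberField

open Literature.NumberTheory.LFunctions.LogFreeLocal Literature.NumberTheory.LFunctions.LogFreeDensity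

/-! ### `L₀ ≠ 0` on `Re s ≥ 1` -/

/-- **`L₀(s, χ) ≠ 0` for `Re s ≥ 1`** (`χ ≠ 1`): Euler product on `Re s > 1`, the zero-free region
of the tree on `Re s = 1`, `t ≠ 0`, and `L(1, χ) ≠ 0`. [cite: ThornerZaman2019, Theorem 3.1] -/
theorem classGroupLFunction₀_ne_zero_of_one_le_re {K : Type} [Field K] [NumberField K]
    {χ : ClassGroup (𝓞 K) →* ℂˣ} (hχ : χ ≠ 1) {s : ℂ} (hs : 1 ≤ s.re) : classGroupLFunction₀ K χ s ≠ 0 := by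
  rcases hs.lt_or_eq with hlt | heq
  · have hs1 : s ≠ 1 := fun h ↦ by rw [h, one_re] at hlt; exact lt_irrefl _ hlt
    rw [classGroupLFunction₀_eq χ hs1 hχ]
    exact classGroupLFunction_ne_zero_of_one_lt_re K χ hlt
  · intro h0
    obtain ⟨c, hc, hzf⟩ := exists_zeroFree_classGroupLFunction₀ (Module.finrank ℚ K)
    have hregion : 1 - c / (Real.log ((discr K).natAbs : ℝ) + Real.log (|s.im| + 4)) < s.re := by
      rw [← heq]
      have : 0 < c / (Real.log ((discr K).natAbs : ℝ) + Real.log (|s.im| + 4)) := by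
        refine div_pos hc ?_
        have h1 : 0 ≤ Real.log ((discr K).natAbs : ℝ) := Real.log_natCast_nonneg _
        have h2 : 0 < Real.log (|s.im| + 4) := Real.log_pos (by linarith [abs_nonneg s.im])
        linarith
      linarith
    obtain ⟨-, him⟩ := hzf K rfl χ hχ s h0 hregion
    have hs1 : s = 1 := Complex.ext (by rw [← heq, one_re]) (by rw [him, one_im])
    rw [hs1] at h0
    exact classGroupLFunction₀_one_ne_zero hχ h0

/-! ### The gamma factor on horizontal segments -/


/-- **`|Γ_ℂ'/Γ_ℂ(σ + it)| ≤ log(|t| + 4) + 11`** for `−1/2 ≤ σ ≤ 2`, `|t| ≥ 2`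
(`Γ_ℂ'/Γ_ℂ = −log 2π + ψ`, `ψ(s) = ψ(s + 1) − 1/s`). [folklore] -/
theorem norm_logDeriv_Gammaℂ_le' {σ t : ℝ} (hσ1 : -(1 / 2) ≤ σ) (hσ2 : σ ≤ 2) (ht : 2 ≤ |t|) :
    ‖logDeriv Gammaℂ (σ + t * I)‖ ≤ Real.log (|t| + 4) + 11 := by
  set s : ℂ := σ + t * I with hs
  have hsre : s.re = σ := by simp [hs]
  have hsim : s.im = t := by simp [hs]
  have ht0 : t ≠ 0 := fun h ↦ by rw [h, abs_zero] at ht; linarith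
  have hsN : ∀ m : ℕ, s ≠ -m := fun m h ↦ by
    have := congrArg Complex.im h; rw [hsim] at this; simp at this; exact ht0 this
  have hs0 : s ≠ 0 := by simpa using hsN 0
  rw [logDeriv_Gammaℂ hsN]
  have hψ : digamma s = digamma (s + 1) - s⁻¹ := by
    rw [Complex.digamma_apply_add_one s hsN]; ring
  rw [hψ]
  set w : ℂ := s + 1 with hw
  have hwre : 0 < w.re := by simp [hw, hsre]; linarith
  have hwim : 1 / 2 ≤ |w.im| := by
    have : w.im = t := by simp [hw, hsim]
    rw [this]; linarith
  have hψw := Literature.Analysis.SpecialFunctions.Complex.norm_digamma_le_log hwre hwim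
  have hwn : ‖w‖ ≤ |t| + 3 := by
    have h1 : ‖s‖ ≤ |σ| + |t| := by simpa [hs] using Complex.norm_le_abs_re_add_abs_im s
    have hσ' : |σ| ≤ 2 := abs_le.2 ⟨by linarith, hσ2⟩
    calc ‖w‖ ≤ ‖s‖ + ‖(1 : ℂ)‖ := norm_add_le _ _
      _ ≤ |t| + 3 := by simp; linarith
  have hlog : Real.log (1 + ‖w‖) ≤ Real.log (|t| + 4) := Real.log_le_log (by positivity) (by linarith)
  have h2π : ‖-Complex.log (2 * π)‖ ≤ 2 := by
    rw [norm_neg, show (2 * (π : ℂ)) = ((2 * Real.pi : ℝ) : ℂ) by push_cast; ring,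
      ← Complex.ofReal_log (by positivity), Complex.norm_real, Real.norm_eq_abs,
      abs_of_pos (Real.log_pos (by linarith [Real.pi_gt_three]))]
    have : Real.log (2 * π) ≤ Real.log (Real.exp 2) := by
      refine Real.log_le_log (by positivity) ?_
      have := Real.pi_lt_d2
      have he : (6.4 : ℝ) ≤ Real.exp 2 := by
        have h1 := Real.add_one_le_exp (1 : ℝ)
        have h2 : Real.exp 2 = Real.exp 1 * Real.exp 1 := by rw [← Real.exp_add]; norm_num
        have h3 := Real.exp_one_gt_d9
        rw [h2]; nlinarith
      linarith
    rwa [Real.log_exp] at this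
  have h1s : ‖s⁻¹‖ ≤ 1 / 2 := by
    rw [norm_inv]
    have : (2 : ℝ) ≤ ‖s‖ := ht.trans (by rw [← hsim]; exact Complex.abs_im_le_norm s)
    rw [inv_eq_one_div]
    exact one_div_le_one_div_of_le two_pos this
  calc ‖-Complex.log (2 * π) + (digamma w - s⁻¹)‖ ≤ ‖-Complex.log (2 * π)‖ + (‖digamma w‖ + ‖s⁻¹‖) := by
        refine (norm_add_le _ _).trans (add_le_add le_rfl (norm_sub_le _ _))
    _ ≤ 2 + ((Real.log (|t| + 4) + 8) + 1 / 2) := by gcongr; linarith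
    _ ≤ Real.log (|t| + 4) + 11 := by linarith

/-- **The Dedekind gamma factor on horizontal segments**:
`‖γ'/γ(σ + it)‖ ≤ ½ log|d_K| + n_K (log(|t| + 4) + 11)` for `−1/2 ≤ σ ≤ 2`, `|t| ≥ 2`. [folklore] -/
theorem norm_logDeriv_dedekindGammaFactor_le_horizontal {K : Type*} [Field K] [NumberField K]
    {σ t : ℝ} (hσ1 : -(1 / 2) ≤ σ) (hσ2 : σ ≤ 2) (ht : 2 ≤ |t|) :
    ‖logDeriv (dedekindGammaFactor K) (σ + t * I)‖ ≤
      Real.log ((discr K).natAbs : ℝ) / 2 + Module.finrank ℚ K * (Real.log (|t| + 4) + 11) := by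
  set s : ℂ := σ + t * I with hs
  have hsim : s.im = t := by simp [hs]
  have ht0 : t ≠ 0 := fun h ↦ by rw [h, abs_zero] at ht; linarith
  have hsN : ∀ m : ℕ, s ≠ -m := fun m h ↦ by
    have := congrArg Complex.im h; rw [hsim] at this; simp at this; exact ht0 this
  have hd1 : (1 : ℝ) ≤ ((discr K).natAbs : ℝ) := by
    have h := Int.one_le_abs (NumberField.discr_ne_zero K)
    rw [Int.abs_eq_natAbs] at h
    exact_mod_cast h
  have hlogd : ‖Complex.log ((discr K).natAbs : ℂ) / 2‖ = Real.log ((discr K).natAbs : ℝ) / 2 := by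
    rw [norm_div, Complex.norm_two, show ((discr K).natAbs : ℂ) = (((discr K).natAbs : ℝ) : ℂ) by push_cast; rfl,
      ← Complex.ofReal_log (by linarith), Complex.norm_real, Real.norm_of_nonneg (Real.log_nonneg hd1)]
  have hℝ := Literature.NumberTheory.LFunctions.PsiOneExplicit.norm_logDeriv_Gammaℝ_le' hσ1 hσ2 ht
  have hℂ := norm_logDeriv_Gammaℂ_le' hσ1 hσ2 ht
  rw [logDeriv_dedekindGammaFactor hsN]
  have hl0 : 0 ≤ Real.log (|t| + 4) := Real.log_nonneg (by linarith [abs_nonneg t])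
  have hr₁ : (nrRealPlaces K : ℝ) + nrComplexPlaces K ≤ Module.finrank ℚ K := by
    have h := card_add_two_mul_card_eq_rank K
    have : (nrRealPlaces K : ℝ) + 2 * nrComplexPlaces K = Module.finrank ℚ K := by exact_mod_cast h
    linarith [(nrComplexPlaces K).cast_nonneg (α := ℝ)]
  calc ‖Complex.log ((discr K).natAbs : ℂ) / 2 + nrRealPlaces K * logDeriv Gammaℝ s + nrComplexPlaces K * logDeriv Gammaℂ s‖
      ≤ ‖Complex.log ((discr K).natAbs : ℂ) / 2‖ + ‖(nrRealPlaces K : ℂ) * logDeriv Gammaℝ s‖ +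
          ‖(nrComplexPlaces K : ℂ) * logDeriv Gammaℂ s‖ := norm_add₃_le
    _ ≤ Real.log ((discr K).natAbs : ℝ) / 2 + nrRealPlaces K * (Real.log (|t| + 4) / 2 + 6) +
          nrComplexPlaces K * (Real.log (|t| + 4) + 11) := by
        rw [hlogd, norm_mul, norm_mul, Complex.norm_natCast, Complex.norm_natCast]
        gcongr
    _ ≤ Real.log ((discr K).natAbs : ℝ) / 2 + Module.finrank ℚ K * (Real.log (|t| + 4) + 11) := by
        have h1 : (nrRealPlaces K : ℝ) * (Real.log (|t| + 4) / 2 + 6) ≤ nrRealPlaces K * (Real.log (|t| + 4) + 11) :=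
          mul_le_mul_of_nonneg_left (by linarith) (Nat.cast_nonneg _)
        nlinarith

/-! ### The functional equation, logarithmically differentiated, at a general point -/

/-- **`L'/L(w, χ) = −γ'/γ(w) − γ'/γ(1 − w) − L'/L(1 − w, χ⁻¹)`** for `w ∉ ℤ` with `L(1 − w, χ⁻¹) ≠ 0`
(and then `L(w, χ) ≠ 0`). [cite: MontgomeryVaughan2007, Lemma 12.8] -/
theorem logDeriv_classGroupLFunction_reflect {K : Type*} [Field K] [NumberField K] (χ : ClassGroup (𝓞 K) →* ℂˣ)
    {w : ℂ} (hwZ : ∀ n : ℤ, w ≠ n) (hL : classGroupLFunction K χ⁻¹ (1 - w) ≠ 0) :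
    classGroupLFunction K χ w ≠ 0 ∧
      logDeriv (classGroupLFunction K χ) w =
        -logDeriv (dedekindGammaFactor K) w - logDeriv (dedekindGammaFactor K) (1 - w) -
          logDeriv (classGroupLFunction K χ⁻¹) (1 - w) := by
  set s₀ : ℂ := 1 - w with hs₀
  have hws : w = 1 - s₀ := by rw [hs₀]; ring
  have hs₀Z : ∀ n : ℤ, s₀ ≠ n := one_sub_ne_int hwZ
  have hwN : ∀ m : ℕ, w ≠ -m := ne_neg_nat_of_ne_int hwZ
  have hs₀N : ∀ m : ℕ, s₀ ≠ -m := ne_neg_nat_of_ne_int hs₀Z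
  have hw1 : w ≠ 1 := fun h ↦ hwZ 1 (by rw [h]; push_cast; ring)
  have hs₀1 : s₀ ≠ 1 := fun h ↦ hs₀Z 1 (by rw [h]; push_cast; ring)
  set W : ℂ := (χ (differentClass K) : ℂ) with hW
  have hW0 : W ≠ 0 := fun h ↦ by
    have := norm_rootNumber (K := K) χ
    rw [← hW, h, norm_zero] at this; exact zero_ne_one this
  set γ := dedekindGammaFactor K with hγdef
  set Lχ := classGroupLFunction K χ with hLχ
  set Lχ' := classGroupLFunction K χ⁻¹ with hLχ'
  have hγw : DifferentiableAt ℂ γ w := differentiableAt_dedekindGammaFactor hwN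
  have hγs : DifferentiableAt ℂ γ s₀ := differentiableAt_dedekindGammaFactor hs₀N
  have hLw : DifferentiableAt ℂ Lχ w := differentiableAt_classGroupLFunction χ hw1
  have hLs : DifferentiableAt ℂ Lχ' s₀ := differentiableAt_classGroupLFunction χ⁻¹ hs₀1
  have hγs0 : γ s₀ ≠ 0 := dedekindGammaFactor_ne_zero hs₀Z
  have hγw0 : γ w ≠ 0 := dedekindGammaFactor_ne_zero hwZ
  have hLs0 : Lχ' s₀ ≠ 0 := hL
  -- the functional equation near `s₀`
  set F : ℂ → ℂ := fun s ↦ γ (1 - s) * Lχ (1 - s) with hF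
  set G : ℂ → ℂ := fun s ↦ W * (γ s * Lχ' s) with hG
  have hFG : F =ᶠ[𝓝 s₀] G := by
    filter_upwards [isOpen_compl_int.mem_nhds hs₀Z] with s hs
    simp only [hF, hG, hγdef, hLχ, hLχ', hW]
    exact completedClassGroupLFunction_one_sub χ hs
  have hFs : F s₀ = γ w * Lχ w := by simp only [hF, hws]
  have hGs : G s₀ = W * (γ s₀ * Lχ' s₀) := rfl
  have hFG0 : F s₀ = G s₀ := hFG.eq_of_nhds
  have hΛw0 : γ w * Lχ w ≠ 0 := by
    rw [← hFs, hFG0, hGs]; exact mul_ne_zero hW0 (mul_ne_zero hγs0 hLs0)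
  have hLw0 : Lχ w ≠ 0 := fun h ↦ hΛw0 (by rw [h, mul_zero])
  refine ⟨hLw0, ?_⟩
  have hΛ : DifferentiableAt ℂ (fun z ↦ γ z * Lχ z) w := hγw.mul hLw
  have hdF : deriv F s₀ = -deriv (fun z ↦ γ z * Lχ z) w := by
    have hcomp : F = (fun z ↦ γ z * Lχ z) ∘ (fun s ↦ 1 - s) := rfl
    have h1 : HasDerivAt (fun s : ℂ ↦ 1 - s) (-1) s₀ := by
      simpa using (hasDerivAt_id s₀).const_sub 1
    have hΛ' : DifferentiableAt ℂ (fun z ↦ γ z * Lχ z) (1 - s₀) := by rw [← hws]; exact hΛ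
    rw [hcomp, deriv_comp s₀ hΛ' h1.differentiableAt, h1.deriv, ← hws]
    ring
  have hdG : deriv G s₀ = W * deriv (fun z ↦ γ z * Lχ' z) s₀ := by
    simp only [hG]
    exact deriv_const_mul W (hγs.mul hLs)
  have hdFG : deriv F s₀ = deriv G s₀ := hFG.deriv_eq
  have hlogΛ : logDeriv (fun z ↦ γ z * Lχ z) w = -logDeriv (fun z ↦ γ z * Lχ' z) s₀ := by
    rw [logDeriv_apply, logDeriv_apply]
    have e1 : deriv (fun z ↦ γ z * Lχ z) w = -deriv F s₀ := by rw [hdF]; ring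
    rw [e1, ← hFs, hFG0, hdFG, hdG, hGs]
    field_simp
  rw [logDeriv_mul w hγw0 hLw0 hγw hLw] at hlogΛ
  rw [logDeriv_mul s₀ hγs0 hLs0 hγs hLs] at hlogΛ
  linear_combination hlogΛ

/-! ### The strip bound at a good height -/

/-- `logDeriv L₀ = logDeriv L` off `s = 1` (`χ ≠ 1`). [folklore] -/
theorem logDeriv_classGroupLFunction₀_eq_logDeriv {K : Type*} [Field K] [NumberField K] {χ : ClassGroup (𝓞 K) →* ℂˣ}
    (hχ : χ ≠ 1) {s : ℂ} (hs : s ≠ 1) :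
    logDeriv (classGroupLFunction₀ K χ) s = logDeriv (classGroupLFunction K χ) s := by
  have heq : classGroupLFunction₀ K χ =ᶠ[𝓝 s] classGroupLFunction K χ := by
    filter_upwards [isOpen_compl_singleton.mem_nhds hs] with z hz
    exact classGroupLFunction₀_eq χ hz hχ
  rw [logDeriv_apply, logDeriv_apply, heq.deriv_eq, heq.eq_of_nhds]

/-- **`L₀'/L₀` on `1/4 ≤ σ ≤ 3/2` at an `η`-separated height** (`χ ≠ 1`): if every zero of `L₀(s, χ)`
with `0 < β < 1` has `|γ − t| ≥ η` (`0 < η ≤ 1`), then for `σ ∈ [1/4, 3/2]`: `L₀(σ + it, χ) ≠ 0` and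
`‖L₀'/L₀(σ + it, χ)‖ ≤ ℒ'_t/η`, `ℒ'_t = lemmaAHeight K t`. [cite: MontgomeryVaughan2007, Lemma 12.6] -/
theorem norm_logDeriv_classGroupLFunction₀_le_of_dist {K : Type} [Field K] [NumberField K]
    {χ : ClassGroup (𝓞 K) →* ℂˣ} (hχ : χ ≠ 1) {t η : ℝ} (hη : 0 < η) (hη1 : η ≤ 1)
    (hsep : ∀ ρ : ℂ, classGroupLFunction₀ K χ ρ = 0 → 0 < ρ.re → ρ.re < 1 → η ≤ |ρ.im - t|)
    {σ : ℝ} (hσ1 : 1 / 4 ≤ σ) (hσ2 : σ ≤ 3 / 2) :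
    classGroupLFunction₀ K χ (σ + t * I) ≠ 0 ∧
      ‖logDeriv (classGroupLFunction₀ K χ) (σ + t * I)‖ ≤ lemmaAHeight K t / η := by
  set f := classGroupLFunction₀ K χ with hf
  set s : ℂ := σ + t * I with hs
  have hsre : s.re = σ := by simp [hs]
  have hsim : s.im = t := by simp [hs]
  have hdf : Differentiable ℂ f := differentiable_classGroupLFunction₀ χ
  have hfc : f (2 + (t : ℂ) * I) ≠ 0 := classGroupLFunction₀_two_add_ne_zero hχ t
  -- every zero of `f` has `0 < β < 1` once `β > 0`... zeros in the disc are non-trivial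
  have hzero_sep : ∀ ρ ∈ discZeros f t, η ≤ ‖s - ρ‖ := by
    intro ρ hρ
    obtain ⟨hmem, h0⟩ := (mem_discZeros hdf hfc).1 hρ
    have hre1 : ρ.re < 1 := by
      by_contra hge; rw [not_lt] at hge
      exact classGroupLFunction₀_ne_zero_of_one_le_re hχ hge h0
    have hre0 : 0 < ρ.re := by
      rw [mem_closedBall, dist_eq_norm] at hmem
      have := Complex.abs_re_le_norm (ρ - (2 + (t : ℂ) * I))
      simp at this
      have h' : |ρ.re - 2| ≤ 31 / 16 := this.trans hmem
      rw [abs_le] at h'; linarith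
    have h1 := hsep ρ h0 hre0 hre1
    calc η ≤ |ρ.im - t| := h1
      _ = |(s - ρ).im| := by rw [Complex.sub_im, hsim, abs_sub_comm]
      _ ≤ ‖s - ρ‖ := Complex.abs_im_le_norm _
  have hfs : f s ≠ 0 := by
    intro h0
    rcases lt_or_ge σ 1 with hσ | hσ
    · have := hsep s h0 (by rw [hsre]; linarith) (by rw [hsre]; exact hσ)
      rw [hsim, sub_self, abs_zero] at this; linarith
    · exact classGroupLFunction₀_ne_zero_of_one_le_re hχ (by rw [hsre]; exact hσ) h0
  refine ⟨hfs, ?_⟩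
  have hsmem : s ∈ closedBall (2 + (t : ℂ) * I) (7 / 4) := by
    rw [mem_closedBall, dist_eq_norm]
    have : s - (2 + (t : ℂ) * I) = ((σ - 2 : ℝ) : ℂ) := by rw [hs]; push_cast; ring
    rw [this, Complex.norm_real, Real.norm_eq_abs, abs_le]; constructor <;> linarith
  have hpf := norm_logDeriv_classGroupLFunction₀_sub_sum_le hχ t hsmem hfs
  have hsum : ‖∑ u ∈ discZeros f t, (discDivisor f t u : ℂ) / (s - u)‖ ≤ 128 * discBound K t / η := by
    calc ‖∑ u ∈ discZeros f t, (discDivisor f t u : ℂ) / (s - u)‖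
        ≤ ∑ u ∈ discZeros f t, ‖(discDivisor f t u : ℂ) / (s - u)‖ := norm_sum_le _ _
      _ ≤ ∑ u ∈ discZeros f t, (discDivisor f t u : ℝ) / η := by
          refine sum_le_sum fun u hu ↦ ?_
          have hm0 : (0 : ℝ) ≤ discDivisor f t u := by exact_mod_cast discDivisor_nonneg hdf t u
          rw [norm_div, show ‖(discDivisor f t u : ℂ)‖ = (discDivisor f t u : ℝ) by
            rw [show (discDivisor f t u : ℂ) = ((discDivisor f t u : ℝ) : ℂ) by norm_cast, Complex.norm_real,
              Real.norm_of_nonneg hm0]]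
          exact div_le_div_of_nonneg_left hm0 hη (hzero_sep u hu)
      _ = (∑ u ∈ discZeros f t, (discDivisor f t u : ℝ)) / η := by rw [sum_div]
      _ ≤ 128 * discBound K t / η := div_le_div_of_nonneg_right (sum_discDivisor_classGroupLFunction₀_le hχ t) hη.le
  have hℒ0 : 0 ≤ discBound K t := le_trans zero_le_one (one_le_discBound K t)
  have hn : (0 : ℝ) ≤ Module.finrank ℚ K := Nat.cast_nonneg _
  calc ‖logDeriv f s‖ ≤ ‖logDeriv f s - ∑ u ∈ discZeros f t, (discDivisor f t u : ℂ) / (s - u)‖ +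
        ‖∑ u ∈ discZeros f t, (discDivisor f t u : ℂ) / (s - u)‖ := norm_le_norm_sub_add _ _
    _ ≤ 217440 * discBound K t + 128 * discBound K t / η := add_le_add hpf hsum
    _ ≤ 217440 * discBound K t / η + 128 * discBound K t / η := by
        refine add_le_add ?_ le_rfl
        rw [le_div_iff₀ hη]
        exact mul_le_of_le_one_right (by positivity) hη1
    _ ≤ lemmaAHeight K t / η := by
        rw [← add_div]
        refine div_le_div_of_nonneg_right ?_ hη.le
        rw [lemmaAHeight]; nlinarith

/-- **`L'/L(σ + it, χ)` on the whole strip `−1/2 ≤ σ ≤ 3/2` at a doubly good height**, uniformly in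
the field (`χ ≠ 1`, `|t| ≥ 2`, `0 < η ≤ 1`): if the non-trivial zeros of `L₀(·, χ)` are `η`-separated
from `t` and those of `L₀(·, χ⁻¹)` from `−t`, then `L(σ + it, χ) ≠ 0` and
`‖L'/L(σ + it, χ)‖ ≤ 3 ℒ'_t/η`. [cite: MontgomeryVaughan2007, Lemma 12.8] -/
theorem norm_logDeriv_classGroupLFunction_le_strip {K : Type} [Field K] [NumberField K]
    {χ : ClassGroup (𝓞 K) →* ℂˣ} (hχ : χ ≠ 1) {t η : ℝ} (ht : 2 ≤ |t|) (hη : 0 < η) (hη1 : η ≤ 1)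
    (hsep : ∀ ρ : ℂ, classGroupLFunction₀ K χ ρ = 0 → 0 < ρ.re → ρ.re < 1 → η ≤ |ρ.im - t|)
    (hsep' : ∀ ρ : ℂ, classGroupLFunction₀ K χ⁻¹ ρ = 0 → 0 < ρ.re → ρ.re < 1 → η ≤ |ρ.im - -t|)
    {σ : ℝ} (hσ1 : -(1 / 2) ≤ σ) (hσ2 : σ ≤ 3 / 2) :
    classGroupLFunction K χ (σ + t * I) ≠ 0 ∧
      ‖logDeriv (classGroupLFunction K χ) (σ + t * I)‖ ≤ 3 * lemmaAHeight K t / η := by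
  have hχ' : χ⁻¹ ≠ 1 := fun h ↦ hχ (by
    ext C
    have := congrArg (fun ψ : ClassGroup (𝓞 K) →* ℂˣ ↦ ((ψ C)⁻¹ : ℂˣ)) h
    simpa using this)
  set s : ℂ := σ + t * I with hs
  have hsre : s.re = σ := by simp [hs]
  have hsim : s.im = t := by simp [hs]
  have ht0 : t ≠ 0 := fun h ↦ by rw [h, abs_zero] at ht; linarith
  have hs1 : s ≠ 1 := fun h ↦ by have := congrArg Complex.im h; rw [hsim] at this; simp at this; exact ht0 this
  have hsZ : ∀ n : ℤ, s ≠ n := ne_int_of_im_ne_zero (by rw [hsim]; exact ht0)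
  have hℒ := one_le_lemmaAHeight (K := K) t
  have hℒ0 : 0 ≤ lemmaAHeight K t := by linarith
  by_cases hσ : 1 / 4 ≤ σ
  · obtain ⟨h0, hb⟩ := norm_logDeriv_classGroupLFunction₀_le_of_dist hχ hη hη1 hsep hσ hσ2
    refine ⟨by rwa [classGroupLFunction₀_eq χ hs1 hχ] at h0, ?_⟩
    rw [← logDeriv_classGroupLFunction₀_eq_logDeriv hχ hs1]
    refine hb.trans ?_
    rw [div_le_div_iff_of_pos_right hη]; nlinarith
  · rw [not_le] at hσ
    -- reflect: `1 − s = (1 − σ) + (−t) i` with `3/4 < 1 − σ ≤ 3/2`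
    have h1s : 1 - s = ((1 - σ : ℝ) : ℂ) + ((-t : ℝ) : ℂ) * I := by rw [hs]; push_cast; ring
    obtain ⟨h0', hb'⟩ := norm_logDeriv_classGroupLFunction₀_le_of_dist hχ' (t := -t) hη hη1 hsep'
      (σ := 1 - σ) (by linarith) (by linarith)
    rw [← h1s] at h0' hb'
    have h1s1 : 1 - s ≠ 1 := fun h ↦ hsZ 0 (by simp at h ⊢; exact h)
    have hL' : classGroupLFunction K χ⁻¹ (1 - s) ≠ 0 := by rwa [classGroupLFunction₀_eq χ⁻¹ h1s1 hχ'] at h0'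
    obtain ⟨hLs0, hformula⟩ := logDeriv_classGroupLFunction_reflect χ hsZ hL'
    refine ⟨hLs0, ?_⟩
    rw [hformula]
    have hγ1 := norm_logDeriv_dedekindGammaFactor_le_horizontal (K := K) hσ1 (by linarith) ht
    have hγ2 := norm_logDeriv_dedekindGammaFactor_le_horizontal (K := K) (σ := 1 - σ) (t := -t)
      (by linarith) (by linarith) (by rwa [abs_neg])
    rw [← hs] at hγ1
    rw [← h1s, abs_neg] at hγ2
    rw [← logDeriv_classGroupLFunction₀_eq_logDeriv hχ' h1s1] 
    have hb'' : ‖logDeriv (classGroupLFunction₀ K χ⁻¹) (1 - s)‖ ≤ lemmaAHeight K t / η := by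
      rw [show lemmaAHeight K t = lemmaAHeight K (-t) by rw [lemmaAHeight, lemmaAHeight, discBound_neg]]; exact hb'
    -- the gamma terms are `≤ lemmaAHeight K t ≤ lemmaAHeight K t / η`
    have hγle : Real.log ((discr K).natAbs : ℝ) / 2 + Module.finrank ℚ K * (Real.log (|t| + 4) + 11) ≤ lemmaAHeight K t := by
      have hd : 0 ≤ Real.log ((discr K).natAbs : ℝ) := Real.log_natCast_nonneg _
      have hn : (0 : ℝ) ≤ Module.finrank ℚ K := Nat.cast_nonneg _
      have hl4 : 0 ≤ Real.log (|t| + 4) := Real.log_nonneg (by linarith [abs_nonneg t])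
      have hl47 : Real.log (|t| + 4) ≤ Real.log (|t| + 7) := Real.log_le_log (by linarith [abs_nonneg t]) (by linarith)
      have hl7 : 1 ≤ Real.log (|t| + 7) := one_le_log_abs_add_seven t
      have hnl : (Module.finrank ℚ K : ℝ) * Real.log (|t| + 4) ≤ Module.finrank ℚ K * Real.log (|t| + 7) :=
        mul_le_mul_of_nonneg_left hl47 hn
      have hnl7 : 0 ≤ (Module.finrank ℚ K : ℝ) * Real.log (|t| + 7) := mul_nonneg hn (by linarith)
      have h11 : Real.log ((discr K).natAbs : ℝ) / 2 + Module.finrank ℚ K * (Real.log (|t| + 4) + 11) ≤ 11 * discBound K t := by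
        rw [discBound]; linarith
      have hD0 : 0 ≤ discBound K t := le_trans zero_le_one (one_le_discBound K t)
      refine h11.trans ?_
      rw [lemmaAHeight]
      refine mul_le_mul_of_nonneg_right ?_ hD0
      nlinarith
    have hγη : lemmaAHeight K t ≤ lemmaAHeight K t / η := by
      rw [le_div_iff₀ hη]; exact mul_le_of_le_one_right hℒ0 hη1
    calc ‖-logDeriv (dedekindGammaFactor K) s - logDeriv (dedekindGammaFactor K) (1 - s) -
          logDeriv (classGroupLFunction₀ K χ⁻¹) (1 - s)‖
        ≤ ‖logDeriv (dedekindGammaFactor K) s‖ + ‖logDeriv (dedekindGammaFactor K) (1 - s)‖ +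
            ‖logDeriv (classGroupLFunction₀ K χ⁻¹) (1 - s)‖ := by
          refine (norm_sub_le _ _).trans (add_le_add ((norm_sub_le _ _).trans (by rw [norm_neg])) le_rfl)
      _ ≤ lemmaAHeight K t / η + lemmaAHeight K t / η + lemmaAHeight K t / η :=
          add_le_add (add_le_add ((hγ1.trans hγle).trans hγη) ((hγ2.trans hγle).trans hγη)) hb''
      _ = 3 * lemmaAHeight K t / η := by ring


/-! ### The same for `ζ_K` -/

/-- Near `w ≠ 1`: `L(w, 1) = ζ_K(w) = ζ₁_K(w)/(w − 1)`, hence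
`(L'/L)(w, 1) = (ζ₁_K'/ζ₁_K)(w) − 1/(w − 1)` when `ζ₁_K(w) ≠ 0`. [folklore] -/
theorem logDeriv_classGroupLFunction_one_eq {K : Type*} [Field K] [NumberField K] {w : ℂ} (hw : w ≠ 1)
    (hζ : dedekindZeta₁ K w ≠ 0) :
    classGroupLFunction K 1 w ≠ 0 ∧
      logDeriv (classGroupLFunction K 1) w = logDeriv (dedekindZeta₁ K) w - 1 / (w - 1) := by
  have heq : classGroupLFunction K 1 =ᶠ[𝓝 w] fun z ↦ (z - 1)⁻¹ * dedekindZeta₁ K z := by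
    filter_upwards [isOpen_compl_singleton.mem_nhds hw] with z hz
    rw [classGroupLFunction_one K hz, dedekindZeta₁_apply_of_ne_one hz]
    field_simp [sub_ne_zero.2 hz]
  have hw1 : w - 1 ≠ 0 := sub_ne_zero.2 hw
  have hval : classGroupLFunction K 1 w = (w - 1)⁻¹ * dedekindZeta₁ K w := heq.eq_of_nhds
  refine ⟨by rw [hval]; exact mul_ne_zero (inv_ne_zero hw1) hζ, ?_⟩
  have h1 : logDeriv (classGroupLFunction K 1) w = logDeriv (fun z ↦ (z - 1)⁻¹ * dedekindZeta₁ K z) w := by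
    rw [logDeriv_apply, logDeriv_apply, heq.deriv_eq, hval]
  have hdinv : DifferentiableAt ℂ (fun z : ℂ ↦ (z - 1)⁻¹) w := (differentiableAt_id.sub_const 1).inv hw1
  have hdζ : DifferentiableAt ℂ (dedekindZeta₁ K) w := (differentiable_dedekindZeta₁ K w)
  have hinv0 : (fun z : ℂ ↦ (z - 1)⁻¹) w ≠ 0 := inv_ne_zero hw1
  rw [h1, logDeriv_mul (f := fun z : ℂ ↦ (z - 1)⁻¹) (g := dedekindZeta₁ K) w hinv0 hζ hdinv hdζ]
  have hlog : logDeriv (fun z : ℂ ↦ (z - 1)⁻¹) w = -(1 / (w - 1)) := by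
    rw [logDeriv_apply]
    have hd : deriv (fun z : ℂ ↦ (z - 1)⁻¹) w = -1 / (w - 1) ^ 2 := by
      have := ((hasDerivAt_id w).sub_const 1).inv hw1
      have h2 := this.deriv
      simp only [id_eq] at h2 ⊢
      rw [show (fun z : ℂ ↦ (z - 1)⁻¹) = (fun x : ℂ ↦ x - 1)⁻¹ from rfl, h2]
    rw [hd]; field_simp
  rw [hlog]; ring

/-- **`ζ₁_K'/ζ₁_K` on `1/4 ≤ σ ≤ 3/2` at an `η`-separated height**: if every zero of `ζ_K` with
`0 < β < 1` has `|γ − t| ≥ η` (`0 < η ≤ 1`), then for `σ ∈ [1/4, 3/2]`: `ζ₁_K(σ + it) ≠ 0` and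
`‖ζ₁_K'/ζ₁_K(σ + it)‖ ≤ ℒ'_t/η`. [cite: MontgomeryVaughan2007, Lemma 12.1] -/
theorem norm_logDeriv_dedekindZeta₁_le_of_dist {K : Type*} [Field K] [NumberField K] {t η : ℝ} (hη : 0 < η) (hη1 : η ≤ 1)
    (hsep : ∀ ρ : ℂ, dedekindZeta₁ K ρ = 0 → 0 < ρ.re → ρ.re < 1 → η ≤ |ρ.im - t|)
    {σ : ℝ} (hσ1 : 1 / 4 ≤ σ) (hσ2 : σ ≤ 3 / 2) :
    dedekindZeta₁ K (σ + t * I) ≠ 0 ∧ ‖logDeriv (dedekindZeta₁ K) (σ + t * I)‖ ≤ lemmaAHeight K t / η := by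
  set f := dedekindZeta₁ K with hf
  set s : ℂ := σ + t * I with hs
  have hsre : s.re = σ := by simp [hs]
  have hsim : s.im = t := by simp [hs]
  have hdf : Differentiable ℂ f := differentiable_dedekindZeta₁ K
  have hfc : f (2 + (t : ℂ) * I) ≠ 0 := dedekindZeta₁_ne_zero_of_one_le_re (by simp)
  have hzero_sep : ∀ ρ ∈ discZeros f t, η ≤ ‖s - ρ‖ := by
    intro ρ hρ
    obtain ⟨hmem, h0⟩ := (mem_discZeros hdf hfc).1 hρ
    have hre1 : ρ.re < 1 := by
      by_contra hge; rw [not_lt] at hge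
      exact dedekindZeta₁_ne_zero_of_one_le_re hge h0
    have hre0 : 0 < ρ.re := by
      rw [mem_closedBall, dist_eq_norm] at hmem
      have := Complex.abs_re_le_norm (ρ - (2 + (t : ℂ) * I))
      simp at this
      have h' : |ρ.re - 2| ≤ 31 / 16 := this.trans hmem
      rw [abs_le] at h'; linarith
    have h1 := hsep ρ h0 hre0 hre1
    calc η ≤ |ρ.im - t| := h1
      _ = |(s - ρ).im| := by rw [Complex.sub_im, hsim, abs_sub_comm]
      _ ≤ ‖s - ρ‖ := Complex.abs_im_le_norm _
  have hfs : f s ≠ 0 := by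
    intro h0
    rcases lt_or_ge σ 1 with hσ | hσ
    · have := hsep s h0 (by rw [hsre]; linarith) (by rw [hsre]; exact hσ)
      rw [hsim, sub_self, abs_zero] at this; linarith
    · exact dedekindZeta₁_ne_zero_of_one_le_re (by rw [hsre]; exact hσ) h0
  refine ⟨hfs, ?_⟩
  have hsmem : s ∈ closedBall (2 + (t : ℂ) * I) (7 / 4) := by
    rw [mem_closedBall, dist_eq_norm]
    have : s - (2 + (t : ℂ) * I) = ((σ - 2 : ℝ) : ℂ) := by rw [hs]; push_cast; ring
    rw [this, Complex.norm_real, Real.norm_eq_abs, abs_le]; constructor <;> linarith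
  have hpf := norm_logDeriv_dedekindZeta₁_sub_sum_le (K := K) t hsmem hfs
  have hsum : ‖∑ u ∈ discZeros f t, (discDivisor f t u : ℂ) / (s - u)‖ ≤ 32 * discBound K t / η := by
    calc ‖∑ u ∈ discZeros f t, (discDivisor f t u : ℂ) / (s - u)‖
        ≤ ∑ u ∈ discZeros f t, ‖(discDivisor f t u : ℂ) / (s - u)‖ := norm_sum_le _ _
      _ ≤ ∑ u ∈ discZeros f t, (discDivisor f t u : ℝ) / η := by
          refine sum_le_sum fun u hu ↦ ?_
          have hm0 : (0 : ℝ) ≤ discDivisor f t u := by exact_mod_cast discDivisor_nonneg hdf t u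
          rw [norm_div, show ‖(discDivisor f t u : ℂ)‖ = (discDivisor f t u : ℝ) by
            rw [show (discDivisor f t u : ℂ) = ((discDivisor f t u : ℝ) : ℂ) by norm_cast, Complex.norm_real,
              Real.norm_of_nonneg hm0]]
          exact div_le_div_of_nonneg_left hm0 hη (hzero_sep u hu)
      _ = (∑ u ∈ discZeros f t, (discDivisor f t u : ℝ)) / η := by rw [sum_div]
      _ ≤ 32 * discBound K t / η := div_le_div_of_nonneg_right (sum_divisor_dedekindZeta₁_bigDisc_le (K := K) t) hη.le
  have hℒ0 : 0 ≤ discBound K t := le_trans zero_le_one (one_le_discBound K t)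
  have hn : (0 : ℝ) ≤ Module.finrank ℚ K := Nat.cast_nonneg _
  calc ‖logDeriv f s‖ ≤ ‖logDeriv f s - ∑ u ∈ discZeros f t, (discDivisor f t u : ℂ) / (s - u)‖ +
        ‖∑ u ∈ discZeros f t, (discDivisor f t u : ℂ) / (s - u)‖ := norm_le_norm_sub_add _ _
    _ ≤ 77760 * discBound K t + 32 * discBound K t / η := add_le_add hpf hsum
    _ ≤ 77760 * discBound K t / η + 32 * discBound K t / η := by
        refine add_le_add ?_ le_rfl
        rw [le_div_iff₀ hη]
        exact mul_le_of_le_one_right (by positivity) hη1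
    _ ≤ lemmaAHeight K t / η := by
        rw [← add_div]
        refine div_le_div_of_nonneg_right ?_ hη.le
        rw [lemmaAHeight]; nlinarith

/-- **`ζ_K'/ζ_K(σ + it)` on the strip `−1/2 ≤ σ ≤ 3/2` at a good height**, uniformly in the field
(`|t| ≥ 2`, `0 < η ≤ 1`, the non-trivial zeros of `ζ_K` `η`-separated from `t` and from `−t`):
`ζ_K(σ + it) ≠ 0` and `‖ζ_K'/ζ_K(σ + it)‖ ≤ 4 ℒ'_t/η` (as `L(·, 1) = ζ_K` off `1`).
[cite: MontgomeryVaughan2007, Lemma 12.2] -/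
theorem norm_logDeriv_classGroupLFunction_one_le_strip {K : Type*} [Field K] [NumberField K]
    {t η : ℝ} (ht : 2 ≤ |t|) (hη : 0 < η) (hη1 : η ≤ 1)
    (hsep : ∀ ρ : ℂ, dedekindZeta₁ K ρ = 0 → 0 < ρ.re → ρ.re < 1 → η ≤ |ρ.im - t|)
    (hsep' : ∀ ρ : ℂ, dedekindZeta₁ K ρ = 0 → 0 < ρ.re → ρ.re < 1 → η ≤ |ρ.im - -t|)
    {σ : ℝ} (hσ1 : -(1 / 2) ≤ σ) (hσ2 : σ ≤ 3 / 2) :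
    classGroupLFunction K 1 (σ + t * I) ≠ 0 ∧
      ‖logDeriv (classGroupLFunction K 1) (σ + t * I)‖ ≤ 4 * lemmaAHeight K t / η := by
  set s : ℂ := σ + t * I with hs
  have hsre : s.re = σ := by simp [hs]
  have hsim : s.im = t := by simp [hs]
  have ht0 : t ≠ 0 := fun h ↦ by rw [h, abs_zero] at ht; linarith
  have hs1 : s ≠ 1 := fun h ↦ by have := congrArg Complex.im h; rw [hsim] at this; simp at this; exact ht0 this
  have hsZ : ∀ n : ℤ, s ≠ n := ne_int_of_im_ne_zero (by rw [hsim]; exact ht0)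
  have hℒ := one_le_lemmaAHeight (K := K) t
  have hℒ0 : 0 ≤ lemmaAHeight K t := by linarith
  have hℒη : 1 ≤ lemmaAHeight K t / η := by
    rw [le_div_iff₀ hη]; nlinarith
  -- `|1/(w − 1)| ≤ 1/2` for `|Im w| = |t| ≥ 2`
  have hinv : ∀ w : ℂ, |w.im| = |t| → ‖(1 : ℂ) / (w - 1)‖ ≤ 1 / 2 := by
    intro w hw
    rw [norm_div, norm_one]
    have : (2 : ℝ) ≤ ‖w - 1‖ := by
      calc (2 : ℝ) ≤ |t| := ht
        _ = |(w - 1).im| := by rw [Complex.sub_im, Complex.one_im, sub_zero, hw]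
        _ ≤ ‖w - 1‖ := Complex.abs_im_le_norm _
    exact one_div_le_one_div_of_le two_pos this
  by_cases hσ : 1 / 4 ≤ σ
  · obtain ⟨h0, hb⟩ := norm_logDeriv_dedekindZeta₁_le_of_dist (K := K) hη hη1 hsep hσ hσ2
    rw [← hs] at h0 hb
    obtain ⟨hL0, hformula⟩ := logDeriv_classGroupLFunction_one_eq hs1 h0
    refine ⟨hL0, ?_⟩
    rw [hformula]
    calc ‖logDeriv (dedekindZeta₁ K) s - 1 / (s - 1)‖ ≤ ‖logDeriv (dedekindZeta₁ K) s‖ + ‖(1 : ℂ) / (s - 1)‖ := norm_sub_le _ _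
      _ ≤ lemmaAHeight K t / η + 1 / 2 := add_le_add hb (hinv s (by rw [hsim]))
      _ ≤ 4 * lemmaAHeight K t / η := by
          have : 4 * lemmaAHeight K t / η = 4 * (lemmaAHeight K t / η) := by ring
          rw [this]; linarith
  · rw [not_le] at hσ
    have h1s : 1 - s = ((1 - σ : ℝ) : ℂ) + ((-t : ℝ) : ℂ) * I := by rw [hs]; push_cast; ring
    obtain ⟨h0', hb'⟩ := norm_logDeriv_dedekindZeta₁_le_of_dist (K := K) (t := -t) hη hη1 hsep'
      (σ := 1 - σ) (by linarith) (by linarith)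
    rw [← h1s] at h0' hb'
    have h1s1 : 1 - s ≠ 1 := fun h ↦ hsZ 0 (by simp at h ⊢; exact h)
    obtain ⟨hL', hformula'⟩ := logDeriv_classGroupLFunction_one_eq h1s1 h0'
    have hinv1 : (1 : ClassGroup (𝓞 K) →* ℂˣ)⁻¹ = 1 := by ext C; simp
    have hL'' : classGroupLFunction K (1 : ClassGroup (𝓞 K) →* ℂˣ)⁻¹ (1 - s) ≠ 0 := by rw [hinv1]; exact hL'
    obtain ⟨hLs0, hformula⟩ := logDeriv_classGroupLFunction_reflect (1 : ClassGroup (𝓞 K) →* ℂˣ) hsZ hL''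
    refine ⟨hLs0, ?_⟩
    rw [hformula, hinv1, hformula']
    have hγ1 := norm_logDeriv_dedekindGammaFactor_le_horizontal (K := K) hσ1 (by linarith) ht
    have hγ2 := norm_logDeriv_dedekindGammaFactor_le_horizontal (K := K) (σ := 1 - σ) (t := -t)
      (by linarith) (by linarith) (by rwa [abs_neg])
    rw [← hs] at hγ1
    rw [← h1s, abs_neg] at hγ2
    have hb'' : ‖logDeriv (dedekindZeta₁ K) (1 - s)‖ ≤ lemmaAHeight K t / η := by
      rw [show lemmaAHeight K t = lemmaAHeight K (-t) by rw [lemmaAHeight, lemmaAHeight, discBound_neg]]; exact hb'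
    have hγle : Real.log ((discr K).natAbs : ℝ) / 2 + Module.finrank ℚ K * (Real.log (|t| + 4) + 11) ≤ lemmaAHeight K t := by
      have hd : 0 ≤ Real.log ((discr K).natAbs : ℝ) := Real.log_natCast_nonneg _
      have hn : (0 : ℝ) ≤ Module.finrank ℚ K := Nat.cast_nonneg _
      have hl4 : 0 ≤ Real.log (|t| + 4) := Real.log_nonneg (by linarith [abs_nonneg t])
      have hl47 : Real.log (|t| + 4) ≤ Real.log (|t| + 7) := Real.log_le_log (by linarith [abs_nonneg t]) (by linarith)
      have hl7 : 1 ≤ Real.log (|t| + 7) := one_le_log_abs_add_seven t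
      have hnl : (Module.finrank ℚ K : ℝ) * Real.log (|t| + 4) ≤ Module.finrank ℚ K * Real.log (|t| + 7) :=
        mul_le_mul_of_nonneg_left hl47 hn
      have hnl7 : 0 ≤ (Module.finrank ℚ K : ℝ) * Real.log (|t| + 7) := mul_nonneg hn (by linarith)
      have h11 : Real.log ((discr K).natAbs : ℝ) / 2 + Module.finrank ℚ K * (Real.log (|t| + 4) + 11) ≤ 11 * discBound K t := by
        rw [discBound]; linarith
      have hD0 : 0 ≤ discBound K t := le_trans zero_le_one (one_le_discBound K t)
      refine h11.trans ?_
      rw [lemmaAHeight]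
      refine mul_le_mul_of_nonneg_right ?_ hD0
      nlinarith
    have hγη : lemmaAHeight K t ≤ lemmaAHeight K t / η := by
      rw [le_div_iff₀ hη]; exact mul_le_of_le_one_right hℒ0 hη1
    have h1sim : |(1 - s).im| = |t| := by simp [hsim]
    calc ‖-logDeriv (dedekindGammaFactor K) s - logDeriv (dedekindGammaFactor K) (1 - s) -
          (logDeriv (dedekindZeta₁ K) (1 - s) - 1 / (1 - s - 1))‖
        ≤ ‖logDeriv (dedekindGammaFactor K) s‖ + ‖logDeriv (dedekindGammaFactor K) (1 - s)‖ +
            (‖logDeriv (dedekindZeta₁ K) (1 - s)‖ + ‖(1 : ℂ) / (1 - s - 1)‖) := by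
          refine (norm_sub_le _ _).trans (add_le_add ((norm_sub_le _ _).trans (by rw [norm_neg])) (norm_sub_le _ _))
      _ ≤ lemmaAHeight K t / η + lemmaAHeight K t / η + (lemmaAHeight K t / η + 1 / 2) :=
          add_le_add (add_le_add ((hγ1.trans hγle).trans hγη) ((hγ2.trans hγle).trans hγη))
            (add_le_add hb'' (hinv (1 - s) h1sim))
      _ ≤ 4 * lemmaAHeight K t / η := by
          have : 4 * lemmaAHeight K t / η = 4 * (lemmaAHeight K t / η) := by ring
          rw [this]; linarith

end Literature.NumberTheory.LFunctions.NumberField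

end
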